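import Summits.Ventures.LatticeQCDFlow.Scoring.UNHaarPowerSumMoments
import HarnessLib

/-!
# The Diaconis–Shahshahani moments at every `N`: `∫_{U(N)} P_σ conj P_τ = Σ_{λ ⊢ K, ℓ(λ) ≤ N} χ^λ(σ) χ^λ(τ)`, and the bound `∫ |P_σ|² ≤ |C(σ)|`

HONEST FRAMING: exact (Metropolis-corrected) sampling algorithms for lattice gauge theory;
figures of merit are autocorrelation/cost numbers at stated couplings and volumes; no
continuum-physics claim.

Venture `LatticeQCDFlow` (cell pub-lqcd), sub-topic `Scoring`; FANOUT row 5 (`s0-sun-a`), GEN-23.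
NEW WORK of the cell (placement rule).  Sequel to `UNHaarPowerSumMoments` (`K ≤ N`): for EVERY `N` and all
`σ, τ ∈ 𝔖_K`, with `P_σ(U) = ∏_{m ∈ cycleType σ} tr(U^m) · (tr U)^{K − Σ cycleType σ}`,

  **`∫_{U(N)} P_σ(U) conj(P_τ(U)) dU = Σ_{λ ⊢ K, ℓ(λ) ≤ N} χ^λ(σ) χ^λ(τ)`**

(`integral_haar_unitaryGroup_cyclePoly_mul_conj_eq_sum_spechtCharacter`; E. M. Rains, *Increasing subsequences
and the classical groups*, Electron. J. Combin. 5 (1998) R12, §1, in character form) — the Haar pairing is the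
coefficient pairing of `G_σ = a_ρ F_σ` and `G_τ` over `N!` (`UNHaarPowerSumMoments`), which is
`Σ_{ℓ(λ) ≤ N} X^λ(σ) X^λ(τ)` (`AlternantFixedWordCoefficients`), and `X^λ = χ^λ` for `ℓ(λ) ≤ N` (Frobenius).
Consequences: **`integral_haar_unitaryGroup_normSq_cyclePoly_le`** — `∫_{U(N)} |P_σ|² ≤ |C_{𝔖_K}(σ)| = ∏_j j^{a_j} a_j!`
for EVERY `N` (drop the constraint `ℓ(λ) ≤ N` in the second orthogonality relation; equality iff `N ≥ K` is
`UNHaarPowerSumMoments`), monotonicity in `N` (`integral_haar_unitaryGroup_normSq_cyclePoly_mono`), and the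
vanishing for different total degrees `K ≠ K'` at every `N` by the central phase
(`integral_haar_unitaryGroup_cyclePoly_mul_conj_of_ne`), which completes Diaconis–Shahshahani's Theorem 2:
`E[∏_j (tr U^j)^{a_j} conj ∏_j (tr U^j)^{b_j}] = δ_{ab} ∏_j j^{a_j} a_j!` whenever `N ≥ Σ j a_j` (any `b`).

No `def`, nothing cited as a fact, 0 sorry.
-/

noncomputable section

open Real MeasureTheory Finset Complex Equiv
open scoped ComplexConjugate
open Literature.MathematicalPhysics.QuantumFieldTheory (haarProbability)
open Literature.RepresentationTheory.CompactGroups.WeylIntegration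
open Literature.RingTheory.SymmetricFunctions.SymmPoly (alternant rho)
open Literature.RepresentationTheory.FiniteGroups (fixedWordPoly spechtCharacter_eq_frobeniusChar)
open Literature.NumberTheory.DiophantineGeometry (spechtCharacter)

namespace Summit.Ventures.LatticeQCDFlow.Scoring

variable {N K : ℕ}

/-! ### 1. The coefficient pairing in character form, every `N` -/

/-- **`Σ_d [x^d]G_σ [x^d]G_τ = N! · Σ_{λ ⊢ K, ℓ(λ) ≤ N} χ^λ(σ) χ^λ(τ)`** for every `N` (Frobenius's formula
`X^λ = χ^λ` needs only `ℓ(λ) ≤ N`, which the sum imposes). -/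
theorem sum_support_coeff_mul_coeff_eq_sum_spechtCharacter (σ τ : Perm (Fin K)) :
    ((∑ d ∈ (alternant (fun i => (MvPolynomial.X i : MvPolynomial (Fin N) ℤ)) (rho N) * fixedWordPoly N σ).support,
        MvPolynomial.coeff d
            (alternant (fun i => (MvPolynomial.X i : MvPolynomial (Fin N) ℤ)) (rho N) * fixedWordPoly N σ) *
          MvPolynomial.coeff d
            (alternant (fun i => (MvPolynomial.X i : MvPolynomial (Fin N) ℤ)) (rho N) * fixedWordPoly N τ) : ℤ) : ℂ)
      = (N.factorial : ℂ) *
          ∑ μ ∈ univ.filter (fun μ : Nat.Partition K => μ.parts.card ≤ N),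
            spechtCharacter ℂ μ σ * spechtCharacter ℂ μ τ := by
  rw [sum_support_coeff_mul_coeff_alternant_mul_fixedWordPoly]
  push_cast
  refine congrArg _ (Finset.sum_congr rfl fun μ hμ => ?_)
  rw [Finset.mem_filter] at hμ
  rw [spechtCharacter_eq_frobeniusChar μ hμ.2 σ, spechtCharacter_eq_frobeniusChar μ hμ.2 τ]

/-! ### 2. The Haar pairing at every `N` -/

/-- **`∫_{U(N)} P_σ(U) conj(P_τ(U)) dU = Σ_{λ ⊢ K, ℓ(λ) ≤ N} χ^λ(σ) χ^λ(τ)` for EVERY `N`** and all `σ, τ ∈ 𝔖_K`. -/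
theorem integral_haar_unitaryGroup_cyclePoly_mul_conj_eq_sum_spechtCharacter (σ τ : Perm (Fin K)) :
    ∫ u, ((σ.cycleType.map fun m => (((u : Matrix.unitaryGroup (Fin N) ℂ) : Matrix (Fin N) (Fin N) ℂ) ^ m).trace).prod *
          ((u : Matrix.unitaryGroup (Fin N) ℂ) : Matrix (Fin N) (Fin N) ℂ).trace ^ (K - σ.cycleType.sum)) *
        conj ((τ.cycleType.map fun m => (((u : Matrix.unitaryGroup (Fin N) ℂ) : Matrix (Fin N) (Fin N) ℂ) ^ m).trace).prod *
          ((u : Matrix.unitaryGroup (Fin N) ℂ) : Matrix (Fin N) (Fin N) ℂ).trace ^ (K - τ.cycleType.sum))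
        ∂(haarProbability (Matrix.unitaryGroup (Fin N) ℂ))
      = ∑ μ ∈ univ.filter (fun μ : Nat.Partition K => μ.parts.card ≤ N),
          spechtCharacter ℂ μ σ * spechtCharacter ℂ μ τ := by
  rw [integral_haar_unitaryGroup_cyclePoly_mul_conj_eq_coeff, sum_support_coeff_mul_coeff_eq_sum_spechtCharacter, ← mul_assoc,
    inv_mul_cancel₀ (Nat.cast_ne_zero.mpr (Nat.factorial_ne_zero _)), one_mul]

/-- **`∫_{U(N)} |P_σ(U)|² dU = Σ_{λ ⊢ K, ℓ(λ) ≤ N} χ^λ(σ)²` for EVERY `N`** (real form; for `σ = 1` this is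
`UNHaarTraceMomentsTableaux`: `∫ |tr U|^{2K} = Σ_{ℓ(λ) ≤ N} (f^λ)²`). -/
theorem integral_haar_unitaryGroup_normSq_cyclePoly_eq_sum (σ : Perm (Fin K)) :
    ∫ u, ‖(σ.cycleType.map fun m => (((u : Matrix.unitaryGroup (Fin N) ℂ) : Matrix (Fin N) (Fin N) ℂ) ^ m).trace).prod *
          ((u : Matrix.unitaryGroup (Fin N) ℂ) : Matrix (Fin N) (Fin N) ℂ).trace ^ (K - σ.cycleType.sum)‖ ^ 2
        ∂(haarProbability (Matrix.unitaryGroup (Fin N) ℂ))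
      = ∑ μ ∈ univ.filter (fun μ : Nat.Partition K => μ.parts.card ≤ N), (spechtCharacter ℂ μ σ).re ^ 2 := by
  have h := integral_haar_unitaryGroup_cyclePoly_mul_conj_eq_sum_spechtCharacter (N := N) σ σ
  have hreal : ∀ μ : Nat.Partition K, spechtCharacter ℂ μ σ = ((spechtCharacter ℂ μ σ).re : ℂ) := fun μ => by
    rw [eq_comm, ← Complex.conj_eq_iff_re]
    exact Literature.RepresentationTheory.FiniteGroups.star_spechtCharacter μ σ
  apply Complex.ofReal_injective
  rw [← integral_complex_ofReal]
  push_cast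
  rw [show ∑ μ ∈ univ.filter (fun μ : Nat.Partition K => μ.parts.card ≤ N), (((spechtCharacter ℂ μ σ).re : ℂ)) ^ 2
      = ∑ μ ∈ univ.filter (fun μ : Nat.Partition K => μ.parts.card ≤ N), spechtCharacter ℂ μ σ * spechtCharacter ℂ μ σ from
    Finset.sum_congr rfl fun μ _ => by rw [sq, ← hreal], ← h]
  refine integral_congr_ae (Filter.Eventually.of_forall fun u => ?_)
  dsimp only
  rw [← Complex.ofReal_pow, ← Complex.normSq_eq_norm_sq, ← Complex.mul_conj]

/-- **`∫_{U(N)} |P_σ(U)|² dU ≤ |C_{𝔖_K}(σ)|` FOR EVERY `N`** (`= ∏_j j^{a_j} a_j!`; equality for `N ≥ K` is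
`integral_haar_unitaryGroup_normSq_cyclePoly`): the Haar moments never exceed the Gaussian ones. -/
theorem integral_haar_unitaryGroup_normSq_cyclePoly_le (σ : Perm (Fin K)) :
    ∫ u, ‖(σ.cycleType.map fun m => (((u : Matrix.unitaryGroup (Fin N) ℂ) : Matrix (Fin N) (Fin N) ℂ) ^ m).trace).prod *
          ((u : Matrix.unitaryGroup (Fin N) ℂ) : Matrix (Fin N) (Fin N) ℂ).trace ^ (K - σ.cycleType.sum)‖ ^ 2
        ∂(haarProbability (Matrix.unitaryGroup (Fin N) ℂ))
      ≤ (Nat.card (Subgroup.centralizer ({σ} : Set (Perm (Fin K)))) : ℝ) := by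
  rw [integral_haar_unitaryGroup_normSq_cyclePoly_eq_sum]
  have h := sum_spechtCharacter_mul_spechtCharacter σ σ
  rw [if_pos (IsConj.refl σ)] at h
  have him : ∀ μ : Nat.Partition K, (spechtCharacter ℂ μ σ).im = 0 := fun μ =>
    Complex.conj_eq_iff_im.mp (Literature.RepresentationTheory.FiniteGroups.star_spechtCharacter μ σ)
  have h2 := congrArg Complex.re h
  rw [Complex.re_sum, Complex.natCast_re] at h2
  rw [← h2]
  refine (Finset.sum_le_sum_of_subset_of_nonneg (Finset.filter_subset _ _) fun μ _ _ => sq_nonneg _).trans_eq ?_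
  exact Finset.sum_congr rfl fun μ _ => by rw [Complex.mul_re, him, mul_zero, sub_zero, sq]

/-- **Monotonicity in `N`**: `∫_{U(N)} |P_σ|² ≤ ∫_{U(N')} |P_σ|²` for `N ≤ N'` (more shapes `λ` with `ℓ(λ) ≤ N'`). -/
theorem integral_haar_unitaryGroup_normSq_cyclePoly_mono {N' : ℕ} (hNN' : N ≤ N') (σ : Perm (Fin K)) :
    ∫ u, ‖(σ.cycleType.map fun m => (((u : Matrix.unitaryGroup (Fin N) ℂ) : Matrix (Fin N) (Fin N) ℂ) ^ m).trace).prod *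
          ((u : Matrix.unitaryGroup (Fin N) ℂ) : Matrix (Fin N) (Fin N) ℂ).trace ^ (K - σ.cycleType.sum)‖ ^ 2
        ∂(haarProbability (Matrix.unitaryGroup (Fin N) ℂ))
      ≤ ∫ u, ‖(σ.cycleType.map fun m => (((u : Matrix.unitaryGroup (Fin N') ℂ) : Matrix (Fin N') (Fin N') ℂ) ^ m).trace).prod *
          ((u : Matrix.unitaryGroup (Fin N') ℂ) : Matrix (Fin N') (Fin N') ℂ).trace ^ (K - σ.cycleType.sum)‖ ^ 2
        ∂(haarProbability (Matrix.unitaryGroup (Fin N') ℂ)) := by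
  rw [integral_haar_unitaryGroup_normSq_cyclePoly_eq_sum, integral_haar_unitaryGroup_normSq_cyclePoly_eq_sum]
  exact Finset.sum_le_sum_of_subset_of_nonneg (fun μ hμ => by
    rw [Finset.mem_filter] at hμ ⊢; exact ⟨hμ.1, hμ.2.trans hNN'⟩) fun μ _ _ => sq_nonneg _

/-! ### 3. Different total degrees: the central phase (every `N`) -/

/-- The centre element `e^{iα}·1` acts on `P_σ` by the phase `e^{iKα}`. -/
theorem cyclePoly_centre_mul (σ : Perm (Fin K)) (α : ℝ) (u : Matrix.unitaryGroup (Fin N) ℂ) :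
    (σ.cycleType.map fun m =>
        ((((⟨Complex.exp (α * I) • 1, exp_mul_I_smul_one_mem_unitaryGroup N α⟩ * u : Matrix.unitaryGroup (Fin N) ℂ)) :
          Matrix (Fin N) (Fin N) ℂ) ^ m).trace).prod *
        (((⟨Complex.exp (α * I) • 1, exp_mul_I_smul_one_mem_unitaryGroup N α⟩ * u : Matrix.unitaryGroup (Fin N) ℂ)) :
          Matrix (Fin N) (Fin N) ℂ).trace ^ (K - σ.cycleType.sum)
      = cexp (α * I) ^ K * ((σ.cycleType.map fun m =>
          (((u : Matrix.unitaryGroup (Fin N) ℂ) : Matrix (Fin N) (Fin N) ℂ) ^ m).trace).prod *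
        ((u : Matrix.unitaryGroup (Fin N) ℂ) : Matrix (Fin N) (Fin N) ℂ).trace ^ (K - σ.cycleType.sum)) := by
  have h : (((⟨Complex.exp (α * I) • 1, exp_mul_I_smul_one_mem_unitaryGroup N α⟩ * u : Matrix.unitaryGroup (Fin N) ℂ)) :
      Matrix (Fin N) (Fin N) ℂ) = cexp (α * I) • ((u : Matrix.unitaryGroup (Fin N) ℂ) : Matrix (Fin N) (Fin N) ℂ) := by
    show (cexp (α * I) • (1 : Matrix (Fin N) (Fin N) ℂ)) * ((u : Matrix.unitaryGroup (Fin N) ℂ) : Matrix (Fin N) (Fin N) ℂ) = _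
    rw [Matrix.smul_mul, one_mul]
  rw [h, cyclePoly_smul]

/-- **Moments of different total degree vanish**: for `σ ∈ 𝔖_K`, `τ ∈ 𝔖_{K'}` with `K ≠ K'` and every `N`,
`∫_{U(N)} P_σ(U) conj(P_τ(U)) dU = 0` (left invariance of Haar measure under the centre element `e^{iπ/(K−K')}·1`,
under which the integrand changes sign) — with §2 this is Diaconis–Shahshahani's Theorem 2 in full:
`E[∏_j (tr U^j)^{a_j} conj ∏_j (tr U^j)^{b_j}] = δ_{ab} ∏_j j^{a_j} a_j!` whenever `N ≥ max(Σ j a_j, Σ j b_j)`. -/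
theorem integral_haar_unitaryGroup_cyclePoly_mul_conj_of_ne {K' : ℕ} (hKK' : K ≠ K') (σ : Perm (Fin K))
    (τ : Perm (Fin K')) :
    ∫ u, ((σ.cycleType.map fun m => (((u : Matrix.unitaryGroup (Fin N) ℂ) : Matrix (Fin N) (Fin N) ℂ) ^ m).trace).prod *
          ((u : Matrix.unitaryGroup (Fin N) ℂ) : Matrix (Fin N) (Fin N) ℂ).trace ^ (K - σ.cycleType.sum)) *
        conj ((τ.cycleType.map fun m => (((u : Matrix.unitaryGroup (Fin N) ℂ) : Matrix (Fin N) (Fin N) ℂ) ^ m).trace).prod *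
          ((u : Matrix.unitaryGroup (Fin N) ℂ) : Matrix (Fin N) (Fin N) ℂ).trace ^ (K' - τ.cycleType.sum))
        ∂(haarProbability (Matrix.unitaryGroup (Fin N) ℂ)) = 0 := by
  set μ := haarProbability (Matrix.unitaryGroup (Fin N) ℂ) with hμ
  set D : ℤ := (K : ℤ) - (K' : ℤ) with hD
  have hD0 : D ≠ 0 := by rw [hD]; omega
  have hcc : cexp (((π / D : ℝ) : ℂ) * I) ^ K * conj (cexp (((π / D : ℝ) : ℂ) * I)) ^ K' = -1 := by
    have hconj : conj (cexp (((π / D : ℝ) : ℂ) * I)) = cexp (-(((π / D : ℝ) : ℂ) * I)) := by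
      rw [← Complex.exp_conj, map_mul, Complex.conj_ofReal, Complex.conj_I, mul_neg]
    rw [hconj, ← Complex.exp_nat_mul, ← Complex.exp_nat_mul, ← Complex.exp_add, ← Complex.exp_pi_mul_I]
    congr 1
    have hDc : ((D : ℝ) : ℂ) ≠ 0 := by exact_mod_cast hD0
    have hjl' : (K : ℂ) - (K' : ℂ) = ((D : ℝ) : ℂ) := by rw [hD]; push_cast; ring
    rw [show (K : ℂ) * (((π / D : ℝ) : ℂ) * I) + K' * -(((π / D : ℝ) : ℂ) * I)
        = ((K : ℂ) - K') * ((π / D : ℝ) : ℂ) * I by ring, hjl']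
    push_cast
    field_simp
  have key := integral_mul_left_eq_self (μ := μ)
    (fun u : Matrix.unitaryGroup (Fin N) ℂ =>
      ((σ.cycleType.map fun m => (((u : Matrix.unitaryGroup (Fin N) ℂ) : Matrix (Fin N) (Fin N) ℂ) ^ m).trace).prod *
          ((u : Matrix.unitaryGroup (Fin N) ℂ) : Matrix (Fin N) (Fin N) ℂ).trace ^ (K - σ.cycleType.sum)) *
        conj ((τ.cycleType.map fun m => (((u : Matrix.unitaryGroup (Fin N) ℂ) : Matrix (Fin N) (Fin N) ℂ) ^ m).trace).prod *
          ((u : Matrix.unitaryGroup (Fin N) ℂ) : Matrix (Fin N) (Fin N) ℂ).trace ^ (K' - τ.cycleType.sum)))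
    ⟨cexp (((π / D : ℝ) : ℂ) * I) • 1, exp_mul_I_smul_one_mem_unitaryGroup N (π / D)⟩
  have hfun : ∀ u : Matrix.unitaryGroup (Fin N) ℂ,
      ((σ.cycleType.map fun m =>
          ((((⟨cexp (((π / D : ℝ) : ℂ) * I) • 1, exp_mul_I_smul_one_mem_unitaryGroup N (π / D)⟩ * u :
            Matrix.unitaryGroup (Fin N) ℂ)) : Matrix (Fin N) (Fin N) ℂ) ^ m).trace).prod *
          (((⟨cexp (((π / D : ℝ) : ℂ) * I) • 1, exp_mul_I_smul_one_mem_unitaryGroup N (π / D)⟩ * u :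
            Matrix.unitaryGroup (Fin N) ℂ)) : Matrix (Fin N) (Fin N) ℂ).trace ^ (K - σ.cycleType.sum)) *
        conj ((τ.cycleType.map fun m =>
          ((((⟨cexp (((π / D : ℝ) : ℂ) * I) • 1, exp_mul_I_smul_one_mem_unitaryGroup N (π / D)⟩ * u :
            Matrix.unitaryGroup (Fin N) ℂ)) : Matrix (Fin N) (Fin N) ℂ) ^ m).trace).prod *
          (((⟨cexp (((π / D : ℝ) : ℂ) * I) • 1, exp_mul_I_smul_one_mem_unitaryGroup N (π / D)⟩ * u :
            Matrix.unitaryGroup (Fin N) ℂ)) : Matrix (Fin N) (Fin N) ℂ).trace ^ (K' - τ.cycleType.sum))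
      = -1 * (((σ.cycleType.map fun m =>
            (((u : Matrix.unitaryGroup (Fin N) ℂ) : Matrix (Fin N) (Fin N) ℂ) ^ m).trace).prod *
          ((u : Matrix.unitaryGroup (Fin N) ℂ) : Matrix (Fin N) (Fin N) ℂ).trace ^ (K - σ.cycleType.sum)) *
        conj ((τ.cycleType.map fun m => (((u : Matrix.unitaryGroup (Fin N) ℂ) : Matrix (Fin N) (Fin N) ℂ) ^ m).trace).prod *
          ((u : Matrix.unitaryGroup (Fin N) ℂ) : Matrix (Fin N) (Fin N) ℂ).trace ^ (K' - τ.cycleType.sum))) := by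
    intro u
    rw [cyclePoly_centre_mul, cyclePoly_centre_mul, map_mul, map_pow, ← hcc]
    ring
  simp_rw [hfun] at key
  rw [integral_const_mul] at key
  linear_combination (-(1 : ℂ) / 2) * key

end Summit.Ventures.LatticeQCDFlow.Scoring
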